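import Literature.Analysis.FluidPDE.KatoWeakDatum
import Literature.Analysis.FluidPDE.NSGaldiEnergyEqualityHolds
import Literature.Analysis.FluidPDE.NSLerayRegularised
import Literature.Analysis.FluidPDE.KatoWeightedDuhamel
import HarnessLib

/-!
# Kato solutions with square-integrable datum are Leray–Hopf weak solutions (ESS 2003, Remark 7.5)

Analysis/FluidPDE proof file (theorems only, everything proved) on the discharge path of the
named fact `Literature.Analysis.FluidPDE.ess_kato_L3_local` (`NSLerayHopfProofs.lean`;
Escauriaza–Seregin–Šverák 2003, Thm. 7.4 with Remark 7.5: for `a ∈ L₃ ∩ J̊` Kato's local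
solution "is in fact the weak Leray–Hopf solution"; Kato 1984, Thm. 4: for `a ∈ L² ∩ PL³` the
mild solution is a weak solution in the energy class with the energy equality). Main result:

* `IsKatoSolutionOn.isLerayHopfOn_of_memLp_two` — let `ν > 0`, `u` a Kato solution on `[0, T₀)`
  (duality-form mild solution in `C([0,T₀); L³(ℝ³))`, `u(0) = u₀`, measurable) with Kato's
  smoothing bound `‖u(t)‖_∞ ≤ C/√t`, and let the datum be square integrable, `u₀ ∈ L²`. Then for
  every `0 < T < T₀`, `u` is a Leray–Hopf weak solution on `[0, T)` with datum `u₀`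
  (`Fluid.IsLerayHopfOn T ν 0 u₀ u`) and `u ∈ L⁴(0, T; L⁴)`.

## Proof

1. `u ∈ L⁴(0,T'; L⁴)`, `T < T' < T₀`: `‖u(t)‖₄⁴ ≤ ‖u(t)‖_∞ ‖u(t)‖₃³ ≤ C M³ t^{-1/2}`.
2. `u` is a weak solution with datum on `[0, T')` (`IsKatoSolutionOn.isWeakNSSolutionOn`,
   `KatoWeakDatum.lean`), so **Galdi's theorem** (`galdi_energy_equality_holds`; Galdi 2019,
   Thm. 1.1, Lions 1960) puts it in the energy class: `u ∈ L^∞(0,T'; L²)`, a slice-wise weak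
   gradient `G` with `∫₀^{T'}∫|G|² < ∞`, and the energy *equality* for a.e. `t ∈ (0, T')`.
3. The a.e. statements are upgraded to every `t ∈ [0, T]` through the `L³`-continuity: the good
   times are dense, every `t < T'` is the limit of good times `rₙ ↓ t`, `u(rₙ) → u(t)` in `L³`,
   and the energy is lower semicontinuous along `L³`-convergent sequences (a.e. subsequence and
   Fatou). Since the dissipation increases with the interval, approaching from above needs no
   continuity of the dissipation: every slice is in `L²` with `‖u(t)‖₂ ≤ ‖u‖_{L^∞L²}`, and the
   energy inequalities from `0` (all `t`) and from a.e. `s` (all `t ≥ s`) follow from the equality.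
4. Weak `L²`-continuity on `[0, T]`: pairings with compactly supported continuous fields are
   continuous by the `L³`-continuity (Hölder `(3, 3/2)`), and the uniform `L²` bound passes to all
   `w ∈ L²` by density; `u(0) = u₀`. Strong attainment of the datum then follows from the energy
   inequality and weak continuity (`fluid_isLerayHopfOn_of_clauses`, `NSLerayRegularised.lean`).

## Mathlib / tree search

Tree: `IsKatoSolutionOn.*` (`KatoMaximalTime`, `KatoLocalLeraySlab`: `exists_forall_eLpNorm_three_le`),
`IsKatoSolutionOn.isWeakNSSolutionOn` (`KatoWeakDatum`), `galdi_energy_equality_holds`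
(`NSGaldiEnergyEqualityHolds`), `fluid_isLerayHopfOn_of_clauses` (`NSLerayRegularised`),
`lintegral_enorm_pow_add_le_essSup_pow_mul`, `eLpNorm_natCast_pow_eq_lintegral`,
`MemLqLp.ae_eLpNorm_le_top`, `eEnergy_eq_eLpNorm_sq` (`LerayHopfProofs`), `eEnergy_eq_ofReal`,
`holderTriple_three_threeHalves_one` (`MildL3Restart`),
`kineticEnergy_nonneg` (`VectorCalculus`), `KatoL3.lintegral_Ioo_rpow_mul_rpow_le`; the weak
continuity argument follows `tendsto_integral_inner_of_continuousOn` (`TaoFiniteEnergyLerayHopf`)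
and `tendsto_integral_inner_of_tendsto_eLpNorm_fourThirds` (`NSGaldiEnergyClass`). Mathlib:
`tendstoInMeasure_of_tendsto_eLpNorm`, `TendstoInMeasure.exists_seq_tendsto_ae`,
`lintegral_liminf_le'`, `MemLp.exists_hasCompactSupport_eLpNorm_sub_le`,
`Continuous.memLp_of_hasCompactSupport`, `ENNReal.pow_le_pow_left_iff`, `Ioo_ae_eq_Ico`.

## References

* L. Escauriaza, G. Seregin, V. Šverák, Russ. Math. Surveys 58:2 (2003), Thm. 7.4, Remark 7.5. [EscauriazaSereginSverak2003]
* T. Kato, Math. Z. 187 (1984) 471–480, Thm. 4 (applications to weak solutions). [Kato1984]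
* G. P. Galdi, Proc. AMS 147 (2019), Thm. 1.1. [Galdi2018]
-/

noncomputable section

open MeasureTheory TopologicalSpace Set Function Filter Topology InnerProductSpace Metric
open scoped RealInnerProductSpace ENNReal NNReal Laplacian

namespace Literature.Analysis.FluidPDE


/-! ### Three tools: lower semicontinuity of the energy, pairings, dense good times -/

section Tools

/-- **Lower semicontinuity of the energy along `L³`-convergent sequences**: if `vₙ → w` in `L³`
and `∫|vₙ|² ≤ C` for all `n`, then `∫|w|² ≤ C` (a subsequence converges a.e.; Fatou). [folklore] -/
theorem eEnergy_le_of_tendsto_eLpNorm_three {v : ℕ → (EuclideanSpace ℝ (Fin 3)) → (EuclideanSpace ℝ (Fin 3))} {w : (EuclideanSpace ℝ (Fin 3)) → (EuclideanSpace ℝ (Fin 3))}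
    (hv : ∀ n, AEStronglyMeasurable (v n) volume) (hw : AEStronglyMeasurable w volume)
    (h : Tendsto (fun n => eLpNorm (v n - w) 3 volume) atTop (𝓝 0)) {C : ℝ≥0∞}
    (hC : ∀ n, eEnergy (v n) ≤ C) : eEnergy w ≤ C := by
  have hmeas : TendstoInMeasure volume v atTop w :=
    tendstoInMeasure_of_tendsto_eLpNorm (by norm_num) hv hw h
  obtain ⟨ns, -, hlim⟩ := hmeas.exists_seq_tendsto_ae
  have hptw : ∀ᵐ x ∂(volume : Measure (EuclideanSpace ℝ (Fin 3))),
      liminf (fun i => ‖v (ns i) x‖ₑ ^ 2) atTop = ‖w x‖ₑ ^ 2 := by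
    filter_upwards [hlim] with x hx
    exact (ENNReal.Tendsto.pow (n := 2) hx.enorm).liminf_eq
  calc eEnergy w = ∫⁻ x, ‖w x‖ₑ ^ 2 := rfl
    _ = ∫⁻ x, liminf (fun i => ‖v (ns i) x‖ₑ ^ 2) atTop := lintegral_congr_ae (hptw.mono fun x hx => hx.symm)
    _ ≤ liminf (fun i => ∫⁻ x, ‖v (ns i) x‖ₑ ^ 2) atTop :=
        lintegral_liminf_le' fun i => ((hv (ns i)).enorm.pow_const 2)
    _ ≤ C := liminf_le_of_frequently_le' (Frequently.of_forall fun i => hC (ns i))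

/-- `⟪v, g⟫` is integrable for `v ∈ L³`, `g ∈ L^{3/2}`. [folklore] -/
theorem integrable_inner_of_memLp_three_threeHalves {v g : (EuclideanSpace ℝ (Fin 3)) → (EuclideanSpace ℝ (Fin 3))} (hv : MemLp v 3 volume)
    (hg : MemLp g (3 / 2) volume) : Integrable (fun x => ⟪v x, g x⟫) volume := by
  haveI := holderTriple_three_threeHalves_one
  have h : MemLp (fun x => ⟪v x, g x⟫) 1 volume :=
    MemLp.of_bilin (fun (a b : (EuclideanSpace ℝ (Fin 3))) => (⟪a, b⟫ : ℝ)) 1 hv hg (hv.1.inner hg.1)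
      (Eventually.of_forall fun x => by simpa using nnnorm_inner_le_nnnorm (v x) (g x))
  exact memLp_one_iff_integrable.1 h

/-- **Pairings against a fixed `L^{3/2}` field are continuous in `L³`** (along any filter, with
the `L³` membership needed only eventually). [folklore] -/
theorem tendsto_integral_inner_of_tendsto_eLpNorm_three {ι : Type*} {l : Filter ι}
    {v : ι → (EuclideanSpace ℝ (Fin 3)) → (EuclideanSpace ℝ (Fin 3))} {w g : (EuclideanSpace ℝ (Fin 3)) → (EuclideanSpace ℝ (Fin 3))} (hv : ∀ᶠ i in l, MemLp (v i) 3 volume)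
    (hw : MemLp w 3 volume) (hg : MemLp g (3 / 2) volume)
    (h : Tendsto (fun i => eLpNorm (v i - w) 3 volume) l (𝓝 0)) :
    Tendsto (fun i => ∫ x, ⟪v i x, g x⟫) l (𝓝 (∫ x, ⟪w x, g x⟫)) := by
  haveI := holderTriple_three_threeHalves_one
  have hbound : ∀ᶠ i in l, edist (∫ x, ⟪v i x, g x⟫) (∫ x, ⟪w x, g x⟫) ≤
      eLpNorm (v i - w) 3 volume * eLpNorm g (3 / 2) volume := by
    filter_upwards [hv] with i hi
    rw [edist_eq_enorm_sub, ← integral_sub (integrable_inner_of_memLp_three_threeHalves hi hg)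
      (integrable_inner_of_memLp_three_threeHalves hw hg)]
    have heq : (fun x => ⟪v i x, g x⟫ - ⟪w x, g x⟫) = fun x => ⟪(v i - w) x, g x⟫ := by
      funext x; rw [Pi.sub_apply, inner_sub_left]
    rw [heq]
    refine (enorm_integral_le_lintegral_enorm _).trans ?_
    rw [← eLpNorm_one_eq_lintegral_enorm]
    have h1 := eLpNorm_le_eLpNorm_mul_eLpNorm_of_nnnorm (hi.sub hw).1 hg.1
      (fun (a b : (EuclideanSpace ℝ (Fin 3))) => (⟪a, b⟫ : ℝ)) 1 (Eventually.of_forall fun x => by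
        simpa using nnnorm_inner_le_nnnorm ((v i - w) x) (g x)) (p := 3) (q := 3 / 2) (r := 1)
    simpa using h1
  have hlim : Tendsto (fun i => eLpNorm (v i - w) 3 volume * eLpNorm g (3 / 2) volume) l (𝓝 0) := by
    have := ENNReal.Tendsto.mul_const h (Or.inr hg.eLpNorm_ne_top)
    rwa [zero_mul] at this
  rw [tendsto_iff_edist_tendsto_0]
  exact tendsto_of_tendsto_of_tendsto_of_le_of_le' tendsto_const_nhds hlim
    (Eventually.of_forall fun _ => bot_le) hbound

/-- **Good times are dense from the right**: if `P` holds for a.e. `s ∈ (a, b)` and `t ∈ [a, b)`,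
there are `rₙ ∈ (t, b)` with `P rₙ` and `rₙ → t`. [folklore] -/
theorem exists_seq_Ioo_tendsto_of_ae_restrict {a b t : ℝ} {P : ℝ → Prop}
    (hP : ∀ᵐ s ∂((volume : Measure ℝ).restrict (Ioo a b)), P s) (ht : t ∈ Ico a b) :
    ∃ r : ℕ → ℝ, (∀ n, r n ∈ Ioo t b ∧ P (r n)) ∧ Tendsto r atTop (𝓝 t) := by
  have hnull : (volume : Measure ℝ) ({s | ¬P s} ∩ Ioo a b) = 0 := by
    have h := ae_iff.1 hP
    rwa [Measure.restrict_apply' measurableSet_Ioo] at h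
  -- a good point in every interval `(t, t + ε) ∩ (t, b)`
  have hstep : ∀ n : ℕ, ∃ r ∈ Ioo t (min b (t + 1 / ((n : ℝ) + 1))), P r := by
    intro n
    by_contra hcon
    have hsub : Ioo t (min b (t + 1 / ((n : ℝ) + 1))) ⊆ {s | ¬P s} ∩ Ioo a b := fun s hs =>
      ⟨fun hPs => hcon ⟨s, hs, hPs⟩, ht.1.trans_lt hs.1, hs.2.trans_le (min_le_left _ _)⟩
    have hzero := measure_mono_null hsub hnull
    have hpos : 0 < (volume : Measure ℝ) (Ioo t (min b (t + 1 / ((n : ℝ) + 1)))) := by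
      rw [Real.volume_Ioo]
      exact ENNReal.ofReal_pos.2 (sub_pos.2 (lt_min ht.2 (by
        have : (0 : ℝ) < 1 / ((n : ℝ) + 1) := by positivity
        linarith)))
    exact absurd hzero hpos.ne'
  choose r hr hPr using hstep
  refine ⟨r, fun n => ⟨⟨(hr n).1, (hr n).2.trans_le (min_le_left _ _)⟩, hPr n⟩, ?_⟩
  have h1 : Tendsto (fun n : ℕ => t + 1 / ((n : ℝ) + 1)) atTop (𝓝 (t + 0)) :=
    tendsto_const_nhds.add tendsto_one_div_add_atTop_nhds_zero_nat
  rw [add_zero] at h1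
  refine tendsto_of_tendsto_of_tendsto_of_le_of_le tendsto_const_nhds h1 (fun n => (hr n).1.le)
    (fun n => ((hr n).2.trans_le (min_le_right _ _)).le)

end Tools

/-! ### Weak `L²` continuity from `L³` continuity and a uniform `L²` bound -/

section WeakContinuity

/-- **Weak `L²` continuity from `L³` continuity.** If every slice `u(t)`, `t ∈ [0, T]`, lies in
`L² ∩ L³` with `‖u(t)‖₂ ≤ a`, and `u ∈ C([0,T]; L³)`, then `t ↦ ∫⟪u(t), w⟫` is continuous on
`[0, T]` for every `w ∈ L²` (pairings with compactly supported continuous fields are continuous by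
Hölder `(3, 3/2)`; density of such fields in `L²` and the uniform bound). [folklore] -/
theorem tendsto_integral_inner_of_continuousInLpOn_three {T : ℝ} {u : ℝ → (EuclideanSpace ℝ (Fin 3)) → (EuclideanSpace ℝ (Fin 3))}
    (hmem : ∀ t ∈ Icc 0 T, MemLp (u t) 2 volume) {a : ℝ} (ha : 0 ≤ a)
    (hbound : ∀ t ∈ Icc 0 T, (eLpNorm (u t) 2 volume).toReal ≤ a)
    (h3 : ContinuousInLpOn (Icc 0 T) 3 u)
    {w : (EuclideanSpace ℝ (Fin 3)) → (EuclideanSpace ℝ (Fin 3))} (hw : MemLp w 2 volume) {t₀ : ℝ} (ht₀ : t₀ ∈ Icc 0 T) :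
    Tendsto (fun t => ∫ x, ⟪u t x, w x⟫) (𝓝[Icc 0 T] t₀) (𝓝 (∫ x, ⟪u t₀ x, w x⟫)) := by
  -- inner products through `L²`
  have hinner : ∀ {g : (EuclideanSpace ℝ (Fin 3)) → (EuclideanSpace ℝ (Fin 3))} (hg : MemLp g 2 volume) (t : ℝ) (ht : t ∈ Icc 0 T),
      ∫ x, ⟪u t x, g x⟫ = ⟪(hmem t ht).toLp (u t), hg.toLp g⟫ := by
    intro g hg t ht
    rw [MeasureTheory.L2.inner_def]
    exact integral_congr_ae (((hmem t ht).coeFn_toLp).mp ((hg.coeFn_toLp).mono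
      fun x h1 h2 => by dsimp only; rw [h1, h2]))
  have hnormU : ∀ t (ht : t ∈ Icc 0 T), ‖(hmem t ht).toLp (u t)‖ ≤ a := by
    intro t ht
    rw [Lp.norm_toLp]
    exact hbound t ht
  -- approximation error: `|∫⟪u t, w⟫ - ∫⟪u t, g⟫| ≤ a ‖w - g‖₂`
  have herr : ∀ {g : (EuclideanSpace ℝ (Fin 3)) → (EuclideanSpace ℝ (Fin 3))} (hg : MemLp g 2 volume) (t : ℝ) (ht : t ∈ Icc 0 T),
      |(∫ x, ⟪u t x, w x⟫) - ∫ x, ⟪u t x, g x⟫| ≤ a * (eLpNorm (w - g) 2 volume).toReal := by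
    intro g hg t ht
    rw [hinner hw t ht, hinner hg t ht, ← inner_sub_right, ← MemLp.toLp_sub,
      ← Lp.norm_toLp (f := w - g) (hf := hw.sub hg)]
    exact (abs_real_inner_le_norm _ _).trans (mul_le_mul_of_nonneg_right (hnormU t ht) (norm_nonneg _))
  -- continuity for compactly supported continuous `g` (Hölder `(3, 3/2)` and `L³` continuity)
  have hcont : ∀ {g : (EuclideanSpace ℝ (Fin 3)) → (EuclideanSpace ℝ (Fin 3))} (_hgc : Continuous g) (_hgs : HasCompactSupport g),
      Tendsto (fun t => ∫ x, ⟪u t x, g x⟫) (𝓝[Icc 0 T] t₀) (𝓝 (∫ x, ⟪u t₀ x, g x⟫)) := by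
    intro g hgc hgs
    have hg32 : MemLp g (3 / 2) volume := hgc.memLp_of_hasCompactSupport hgs
    refine tendsto_integral_inner_of_tendsto_eLpNorm_three ?_ (h3.1 t₀ ht₀) hg32 (h3.2 t₀ ht₀)
    filter_upwards [self_mem_nhdsWithin] with t ht using h3.1 t ht
  rw [Metric.tendsto_nhdsWithin_nhds]
  intro δ hδ
  -- choose `g`
  obtain ⟨g, hgs, hgε, hgc, hg2⟩ := hw.exists_hasCompactSupport_eLpNorm_sub_le ENNReal.ofNat_ne_top
    (ε := ENNReal.ofReal (δ / (3 * (a + 1)))) (by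
      rw [← pos_iff_ne_zero, ENNReal.ofReal_pos]; positivity)
  have hgε' : (eLpNorm (w - g) 2 volume).toReal ≤ δ / (3 * (a + 1)) := by
    have := ENNReal.toReal_mono ENNReal.ofReal_ne_top hgε
    rwa [ENNReal.toReal_ofReal (by positivity)] at this
  have hae : a * (eLpNorm (w - g) 2 volume).toReal ≤ δ / 3 := by
    calc a * (eLpNorm (w - g) 2 volume).toReal ≤ a * (δ / (3 * (a + 1))) :=
          mul_le_mul_of_nonneg_left hgε' ha
      _ ≤ δ / 3 := by
          rw [mul_div_assoc', div_le_div_iff₀ (by positivity) (by positivity)]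
          nlinarith
  have hc := hcont hgc hgs
  rw [Metric.tendsto_nhdsWithin_nhds] at hc
  obtain ⟨η, hη, hηP⟩ := hc (δ / 3) (by positivity)
  refine ⟨η, hη, fun t ht hd => ?_⟩
  have h1 := herr hg2 t ht
  have h2 := herr hg2 t₀ ht₀
  have h3' := hηP ht hd
  rw [Real.dist_eq] at h3' ⊢
  have key : (∫ x, ⟪u t x, w x⟫) - ∫ x, ⟪u t₀ x, w x⟫ =
      ((∫ x, ⟪u t x, w x⟫) - ∫ x, ⟪u t x, g x⟫) + ((∫ x, ⟪u t x, g x⟫) - ∫ x, ⟪u t₀ x, g x⟫) -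
        ((∫ x, ⟪u t₀ x, w x⟫) - ∫ x, ⟪u t₀ x, g x⟫) := by ring
  rw [key]
  set X1 : ℝ := (∫ x, ⟪u t x, w x⟫) - ∫ x, ⟪u t x, g x⟫
  set X2 : ℝ := (∫ x, ⟪u t x, g x⟫) - ∫ x, ⟪u t₀ x, g x⟫
  set X3 : ℝ := (∫ x, ⟪u t₀ x, w x⟫) - ∫ x, ⟪u t₀ x, g x⟫
  have i1 : |X1 + X2 - X3| ≤ |X1 + X2| + |X3| := abs_sub _ _
  have i2 : |X1 + X2| ≤ |X1| + |X2| := abs_add_le _ _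
  linarith

end WeakContinuity

/-! ### The main theorem -/

section Main

variable {T₀ T ν : ℝ} {u₀ : (EuclideanSpace ℝ (Fin 3)) → (EuclideanSpace ℝ (Fin 3))} {u : ℝ → (EuclideanSpace ℝ (Fin 3)) → (EuclideanSpace ℝ (Fin 3))}

/-- **`L^∞ ∩ L³ ⊂ L⁴` on a slice**: `‖f‖₄⁴ ≤ ‖f‖_∞ ‖f‖₃³`. [folklore] -/
theorem eLpNorm_four_pow_le_top_mul_three_pow {f : (EuclideanSpace ℝ (Fin 3)) → (EuclideanSpace ℝ (Fin 3))} (hf : AEStronglyMeasurable f volume) :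
    eLpNorm f 4 volume ^ 4 ≤ eLpNorm f ∞ volume * eLpNorm f 3 volume ^ 3 := by
  have h4 := eLpNorm_natCast_pow_eq_lintegral (volume : Measure (EuclideanSpace ℝ (Fin 3))) f (n := 4) (by norm_num)
  have h3 := eLpNorm_natCast_pow_eq_lintegral (volume : Measure (EuclideanSpace ℝ (Fin 3))) f (n := 3) (by norm_num)
  simp only [Nat.cast_ofNat] at h4 h3
  rw [h4, h3, eLpNorm_exponent_top]
  have h := lintegral_enorm_pow_add_le_essSup_pow_mul hf 1 3
  simpa only [pow_one] using h

/-- **`u ∈ L⁴(0,T; L⁴)` for a Kato solution with Kato's smoothing bound** (`T < T₀`):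
`‖u(t)‖₄⁴ ≤ ‖u(t)‖_∞ ‖u(t)‖₃³ ≤ |C| M³ t^{-1/2}`, integrable on `(0, T)` — the `L₄(Q_T)` half of
ESS 2003, (7.31). [cite: EscauriazaSereginSverak2003, Thm. 7.4 (7.31)] -/
theorem IsKatoSolutionOn.memLqLp_four (hu : IsKatoSolutionOn T₀ ν u₀ u) {C : ℝ}
    (hinf : ∀ t ∈ Ioo 0 T₀, eLpNorm (u t) ∞ volume ≤ ENNReal.ofReal (C / Real.sqrt t))
    (hT : T < T₀) (hT0 : 0 < T) : MemLqLp 4 4 u (Ioo 0 T) := by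
  obtain ⟨M, hM⟩ := hu.exists_forall_eLpNorm_three_le hT
  have hslice : ∀ t ∈ Ioo 0 T, MemLp (u t) 4 volume ∧
      eLpNorm (u t) 4 volume ^ 4 ≤ ENNReal.ofReal |C| * (M : ℝ≥0∞) ^ 3 * ENNReal.ofReal (t ^ (-(1 / 2 : ℝ))) := by
    intro t ht
    have hm : AEStronglyMeasurable (u t) volume := (hu.memLp ⟨ht.1.le, ht.2.trans hT⟩).1
    have hle : eLpNorm (u t) 4 volume ^ 4 ≤
        ENNReal.ofReal |C| * (M : ℝ≥0∞) ^ 3 * ENNReal.ofReal (t ^ (-(1 / 2 : ℝ))) := by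
      calc eLpNorm (u t) 4 volume ^ 4 ≤ eLpNorm (u t) ∞ volume * eLpNorm (u t) 3 volume ^ 3 :=
            eLpNorm_four_pow_le_top_mul_three_pow hm
        _ ≤ ENNReal.ofReal (C / Real.sqrt t) * (M : ℝ≥0∞) ^ 3 := by
            gcongr
            · exact hinf t ⟨ht.1, ht.2.trans hT⟩
            · exact hM t ⟨ht.1.le, ht.2.le⟩
        _ ≤ ENNReal.ofReal (|C| * t ^ (-(1 / 2 : ℝ))) * (M : ℝ≥0∞) ^ 3 := by
            gcongr
            rw [Real.sqrt_eq_rpow, div_eq_mul_inv, ← Real.rpow_neg ht.1.le]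
            exact mul_le_mul_of_nonneg_right (le_abs_self C) (Real.rpow_nonneg ht.1.le _)
        _ = _ := by rw [ENNReal.ofReal_mul (abs_nonneg C)]; ring
    refine ⟨⟨hm, ?_⟩, hle⟩
    have hfin : eLpNorm (u t) 4 volume ^ 4 < ∞ :=
      hle.trans_lt (ENNReal.mul_lt_top (ENNReal.mul_lt_top ENNReal.ofReal_lt_top
        (ENNReal.pow_lt_top ENNReal.coe_lt_top)) ENNReal.ofReal_lt_top)
    exact (ENNReal.pow_lt_top_iff.1 hfin).resolve_right (by norm_num)
  refine ⟨(ae_restrict_iff' measurableSet_Ioo).2 (Eventually.of_forall fun t ht => (hslice t ht).1), ?_⟩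
  rw [eLqLpNorm, eLpNorm_lt_top_iff_lintegral_rpow_enorm_lt_top (by norm_num) (by norm_num)]
  simp only [ENNReal.toReal_ofNat]
  have key : ∀ t ∈ Ioo 0 T, ‖(eLpNorm (u t) 4 volume).toReal‖ₑ ^ (4 : ℝ) ≤
      ENNReal.ofReal |C| * (M : ℝ≥0∞) ^ 3 * ENNReal.ofReal ((T - t) ^ (-(0 : ℝ)) * t ^ (-(1 / 2 : ℝ))) := by
    intro t ht
    rw [Real.enorm_eq_ofReal ENNReal.toReal_nonneg, ENNReal.ofReal_toReal (hslice t ht).1.eLpNorm_ne_top,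
      show (4 : ℝ) = ((4 : ℕ) : ℝ) by norm_num, ENNReal.rpow_natCast, neg_zero, Real.rpow_zero, one_mul]
    exact (hslice t ht).2
  refine lt_of_le_of_lt (setLIntegral_mono' measurableSet_Ioo key) ?_
  rw [lintegral_const_mul' _ _ (ENNReal.mul_ne_top ENNReal.ofReal_ne_top (ENNReal.pow_ne_top ENNReal.coe_ne_top))]
  refine ENNReal.mul_lt_top (ENNReal.mul_lt_top ENNReal.ofReal_lt_top (ENNReal.pow_lt_top ENNReal.coe_lt_top)) ?_
  exact (KatoL3.lintegral_Ioo_rpow_mul_rpow_le (α := 0) (β := 1 / 2) le_rfl (by norm_num) (by norm_num)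
    (by norm_num) hT0).trans_lt ENNReal.ofReal_lt_top

/-- **Kato solutions with square-integrable datum are Leray–Hopf weak solutions**
(Escauriaza–Seregin–Šverák 2003, Remark 7.5: "the function `u` of Theorem 7.4 is in fact the weak
Leray–Hopf solution"; Kato 1984, Thm. 4). Let `ν > 0`, let `u` be a Kato solution on `[0, T₀)`
with Kato's smoothing bound `‖u(t)‖_∞ ≤ C/√t`, and let `u₀ ∈ L²`. Then for `0 < T < T₀`, `u` is a
Leray–Hopf weak solution on `[0, T)` from `u₀` (accepted `Fluid.IsLerayHopfOn T ν 0 u₀ u`: weak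
formulation with datum, energy class through Galdi's theorem, energy inequalities for every time
from the a.e. energy equality and the `L³`-continuity, weak `L²` continuity, strong attainment
of the datum) and `u ∈ L⁴(0,T; L⁴)`. [cite: EscauriazaSereginSverak2003, Thm. 7.4 with Remark 7.5] -/
theorem IsKatoSolutionOn.isLerayHopfOn_of_memLp_two (hν : 0 < ν) (hu : IsKatoSolutionOn T₀ ν u₀ u)
    (hu₀2 : MemLp u₀ 2 volume) {C : ℝ}
    (hinf : ∀ t ∈ Ioo 0 T₀, eLpNorm (u t) ∞ volume ≤ ENNReal.ofReal (C / Real.sqrt t))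
    (hT : T < T₀) (hT0 : 0 < T) :
    IsLerayHopfOn T ν 0 u₀ u ∧ MemLqLp 4 4 u (Ioo 0 T) := by
  have hT₀ : 0 < T₀ := hT0.trans hT
  -- an intermediate horizon `T < T' < T₀`
  set T' : ℝ := (T + T₀) / 2 with hT'def
  have hTT' : T < T' := by rw [hT'def]; linarith
  have hT'T₀ : T' < T₀ := by rw [hT'def]; linarith
  have hT'0 : 0 < T' := hT0.trans hTT'
  -- slices
  have hsl : ∀ t ∈ Ico 0 T₀, AEStronglyMeasurable (u t) volume := fun t ht => (hu.memLp ht).1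
  have hsl3 : ∀ t ∈ Ico 0 T₀, MemLp (u t) 3 volume := fun t ht => hu.memLp ht
  -- (1) `L⁴` on `(0, T')`
  have h4' : MemLqLp 4 4 u (Ioo 0 T') := hu.memLqLp_four hinf hT'T₀ hT'0
  -- (2) weak formulation and Galdi's theorem on `[0, T')`
  have hW' : IsWeakNSSolutionOn T' ν 0 u₀ u := hu.isWeakNSSolutionOn hν hT'T₀ hT'0
  have hdiv₀ : IsWeaklyDivFree u₀ := hu.isWeaklyDivFree_initial hT₀
  obtain ⟨hL2, G, hG, hGint, hEq⟩ := galdi_energy_equality_holds hν hT'0 hu₀2 hdiv₀ hW' h4'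
  set E₂ : ℝ≥0∞ := eLqLpNorm ∞ 2 u (Ioo 0 T') with hE₂
  have hE₂t : E₂ < ∞ := hL2.2
  -- the dissipation `D a b = ∫ₐᵇ ∫ |G|²` (real) and its extended version
  set eD : ℝ → ℝ → ℝ≥0∞ := fun a b => ∫⁻ τ in Ioo a b, ∫⁻ x, ENNReal.ofReal (frobeniusNormSq (G τ x))
    with heD
  have heD_le : ∀ a b, b ≤ T' → 0 ≤ a → eD a b ≤ eD 0 T' := fun a b hb ha =>
    lintegral_mono_set (Ioo_subset_Ioo ha hb)
  have heD_fin : ∀ a b, b ≤ T' → 0 ≤ a → eD a b ≠ ∞ := fun a b hb ha =>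
    ((heD_le a b hb ha).trans_lt hGint).ne
  have heD_add : ∀ {s t : ℝ}, 0 ≤ s → s < t → eD 0 t = eD 0 s + eD s t := by
    intro s t hs hst
    simp only [heD]
    have hdisj : Disjoint (Ioc 0 s) (Ioo s t) :=
      Set.disjoint_left.2 fun x hx hx' => (not_lt.2 hx.2) hx'.1
    rw [← Ioc_union_Ioo_eq_Ioo hs hst, lintegral_union measurableSet_Ioo hdisj,
      setLIntegral_congr (Ioo_ae_eq_Ioc (μ := (volume : Measure ℝ)) (a := 0) (b := s)).symm]
  -- the real dissipation
  set D : ℝ → ℝ → ℝ := fun a b => (eD a b).toReal with hD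
  have hD00 : ∀ a, D a a = 0 := fun a => by simp [hD, heD]
  -- good times: `L²` bound and energy equality
  have hgood : ∀ᵐ s ∂(volume.restrict (Ioo 0 T')),
      (MemLp (u s) 2 volume ∧ eLpNorm (u s) 2 volume ≤ E₂) ∧
        VectorCalculus.kineticEnergy (u s) + ν * D 0 s = VectorCalculus.kineticEnergy u₀ := by
    filter_upwards [hL2.1, hL2.ae_eLpNorm_le_top, hEq] with s h1 h2 h3
    exact ⟨⟨h1, h2⟩, h3⟩
  -- approach from the right by good times, with `L³` convergence
  have happroach : ∀ t ∈ Ico 0 T', ∃ r : ℕ → ℝ,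
      (∀ n, r n ∈ Ioo t T' ∧ ((MemLp (u (r n)) 2 volume ∧ eLpNorm (u (r n)) 2 volume ≤ E₂) ∧
        VectorCalculus.kineticEnergy (u (r n)) + ν * D 0 (r n) = VectorCalculus.kineticEnergy u₀)) ∧
      Tendsto (fun n => eLpNorm (u (r n) - u t) 3 volume) atTop (𝓝 0) := by
    intro t ht
    obtain ⟨r, hr, hrt⟩ := exists_seq_Ioo_tendsto_of_ae_restrict hgood ht
    refine ⟨r, hr, ?_⟩
    have htI : t ∈ Ico 0 T₀ := ⟨ht.1, ht.2.trans hT'T₀⟩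
    have hc := hu.continuousInLpOn.2 t htI
    have hr' : Tendsto r atTop (𝓝[Ico 0 T₀] t) :=
      tendsto_nhdsWithin_iff.2 ⟨hrt, Eventually.of_forall fun n =>
        ⟨ht.1.trans (hr n).1.1.le, (hr n).1.2.trans hT'T₀⟩⟩
    exact hc.comp hr'
  have hrI : ∀ (t : ℝ), t ∈ Ico 0 T' → ∀ (r : ℕ → ℝ), (∀ n, r n ∈ Ioo t T' ∧
      ((MemLp (u (r n)) 2 volume ∧ eLpNorm (u (r n)) 2 volume ≤ E₂) ∧
        VectorCalculus.kineticEnergy (u (r n)) + ν * D 0 (r n) = VectorCalculus.kineticEnergy u₀)) →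
      ∀ n : ℕ, r n ∈ Ico 0 T₀ := fun t ht r hr n => ⟨ht.1.trans (hr n).1.1.le, (hr n).1.2.trans hT'T₀⟩
  -- (3a) every slice is in `L²`, `‖u(t)‖₂ ≤ E₂`, on `[0, T')`
  have hA : ∀ t ∈ Ico 0 T', MemLp (u t) 2 volume ∧ eLpNorm (u t) 2 volume ≤ E₂ := by
    intro t ht
    obtain ⟨r, hr, hlim⟩ := happroach t ht
    have htI : t ∈ Ico 0 T₀ := ⟨ht.1, ht.2.trans hT'T₀⟩
    have hE : eEnergy (u t) ≤ E₂ ^ 2 := by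
      refine eEnergy_le_of_tendsto_eLpNorm_three (fun n => hsl _ (hrI _ ht _ hr n)) (hsl t htI) hlim fun n => ?_
      rw [eEnergy_eq_eLpNorm_sq]
      gcongr
      exact (hr n).2.1.2
    have h2 : eLpNorm (u t) 2 volume ≤ E₂ := by
      rw [eEnergy_eq_eLpNorm_sq] at hE
      exact (ENNReal.pow_le_pow_left_iff two_ne_zero).1 hE
    exact ⟨⟨hsl t htI, h2.trans_lt hE₂t⟩, h2⟩
  -- (3b) the energy inequality from `0`, every `t ∈ [0, T')`
  have hB : ∀ t ∈ Ico 0 T', VectorCalculus.kineticEnergy (u t) + ν * D 0 t ≤ VectorCalculus.kineticEnergy u₀ := by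
    intro t ht
    obtain ⟨r, hr, hlim⟩ := happroach t ht
    have hDmono : ∀ n, D 0 t ≤ D 0 (r n) := fun n =>
      ENNReal.toReal_mono (heD_fin 0 (r n) (hr n).1.2.le le_rfl)
        (lintegral_mono_set (Ioo_subset_Ioo_right (hr n).1.1.le))
    have hKEn : ∀ n, VectorCalculus.kineticEnergy (u (r n)) ≤ VectorCalculus.kineticEnergy u₀ - ν * D 0 t := by
      intro n
      have h1 := (hr n).2.2
      nlinarith [hDmono n, hν]
    have hB0 : 0 ≤ VectorCalculus.kineticEnergy u₀ - ν * D 0 t := (kineticEnergy_nonneg _).trans (hKEn 0)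
    have hE : eEnergy (u t) ≤ ENNReal.ofReal (2 * (VectorCalculus.kineticEnergy u₀ - ν * D 0 t)) := by
      refine eEnergy_le_of_tendsto_eLpNorm_three (fun n => hsl _ (hrI _ ht _ hr n))
        (hsl t ⟨ht.1, ht.2.trans hT'T₀⟩) hlim fun n => ?_
      rw [eEnergy_eq_ofReal _ (hr n).2.1.1]
      exact ENNReal.ofReal_le_ofReal (by linarith [hKEn n])
    rw [eEnergy_eq_ofReal _ (hA t ht).1] at hE
    have := (ENNReal.ofReal_le_ofReal_iff (by linarith)).1 hE
    linarith
  -- (3c) the energy inequality from a.e. `s ∈ (0, T)`, every `t ∈ [s, T]`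
  have hCineq : ∀ᵐ s ∂(volume.restrict (Ioo 0 T)), ∀ t ∈ Icc s T,
      VectorCalculus.kineticEnergy (u t) + ν * D s t ≤ VectorCalculus.kineticEnergy (u s) := by
    have hgoodT := ae_restrict_of_ae_restrict_of_subset (μ := (volume : Measure ℝ))
      (Ioo_subset_Ioo_right hTT'.le) hgood
    filter_upwards [hgoodT, ae_restrict_mem measurableSet_Ioo] with s hs hsI
    intro t ht
    rcases ht.1.eq_or_lt with h | hst
    · rw [← h, hD00, mul_zero, add_zero]
    · have htI' : t ∈ Ico 0 T' := ⟨hsI.1.le.trans ht.1, ht.2.trans_lt hTT'⟩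
      obtain ⟨r, hr, hlim⟩ := happroach t htI'
      have hadd : D 0 t = D 0 s + D s t := by
        simp only [hD]
        rw [heD_add hsI.1.le hst, ENNReal.toReal_add (heD_fin 0 s (hst.le.trans htI'.2.le) le_rfl)
          (heD_fin s t htI'.2.le hsI.1.le)]
      have hDmono : ∀ n, D 0 t ≤ D 0 (r n) := fun n =>
        ENNReal.toReal_mono (heD_fin 0 (r n) (hr n).1.2.le le_rfl)
          (lintegral_mono_set (Ioo_subset_Ioo_right (hr n).1.1.le))
      have hKEn : ∀ n, VectorCalculus.kineticEnergy (u (r n)) ≤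
          VectorCalculus.kineticEnergy (u s) - ν * D s t := by
        intro n
        have h1 := (hr n).2.2
        have h2 := hs.2
        nlinarith [hDmono n, hν, hadd]
      have hB0 : 0 ≤ VectorCalculus.kineticEnergy (u s) - ν * D s t :=
        (kineticEnergy_nonneg _).trans (hKEn 0)
      have hE : eEnergy (u t) ≤ ENNReal.ofReal (2 * (VectorCalculus.kineticEnergy (u s) - ν * D s t)) := by
        refine eEnergy_le_of_tendsto_eLpNorm_three (fun n => hsl _ (hrI _ htI' _ hr n))
          (hsl t ⟨htI'.1, htI'.2.trans hT'T₀⟩) hlim fun n => ?_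
        rw [eEnergy_eq_ofReal _ (hr n).2.1.1]
        exact ENNReal.ofReal_le_ofReal (by linarith [hKEn n])
      rw [eEnergy_eq_ofReal _ (hA t htI').1] at hE
      have := (ENNReal.ofReal_le_ofReal_iff (by linarith)).1 hE
      linarith
  -- (4) weak `L²` continuity on `[0, T]`
  have hmemT : ∀ t ∈ Icc 0 T, MemLp (u t) 2 volume := fun t ht => (hA t ⟨ht.1, ht.2.trans_lt hTT'⟩).1
  have hboundT : ∀ t ∈ Icc 0 T, (eLpNorm (u t) 2 volume).toReal ≤ E₂.toReal := fun t ht =>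
    ENNReal.toReal_mono hE₂t.ne (hA t ⟨ht.1, ht.2.trans_lt hTT'⟩).2
  have h3T : ContinuousInLpOn (Icc 0 T) 3 u := hu.continuousInLpOn.mono (Icc_subset_Ico_right hT)
  have hWC : ∀ w : (EuclideanSpace ℝ (Fin 3)) → (EuclideanSpace ℝ (Fin 3)), MemLp w 2 volume →
      ContinuousOn (fun t => ∫ x, ⟪u t x, w x⟫) (Ioc 0 T) ∧
        Tendsto (fun t => ∫ x, ⟪u t x, w x⟫) (𝓝[>] 0) (𝓝 (∫ x, ⟪u₀ x, w x⟫)) := by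
    intro w hw
    have key : ∀ t₀ ∈ Icc 0 T, Tendsto (fun t => ∫ x, ⟪u t x, w x⟫) (𝓝[Icc 0 T] t₀)
        (𝓝 (∫ x, ⟪u t₀ x, w x⟫)) := fun t₀ ht₀ =>
      tendsto_integral_inner_of_continuousInLpOn_three hmemT ENNReal.toReal_nonneg hboundT h3T hw ht₀
    refine ⟨fun t₀ ht₀ => (key t₀ (Ioc_subset_Icc_self ht₀)).mono_left (nhdsWithin_mono _ Ioc_subset_Icc_self), ?_⟩
    have h0 := key 0 ⟨le_rfl, hT0.le⟩
    rw [hu.initial] at h0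
    refine h0.mono_left ?_
    rw [← nhdsWithin_Ioo_eq_nhdsGT hT0]
    exact nhdsWithin_mono _ Ioo_subset_Icc_self
  -- the forcing terms vanish
  have hz : ∀ a b : ℝ, (∫ τ in a..b, ∫ x, ⟪(0 : ℝ → (EuclideanSpace ℝ (Fin 3)) → (EuclideanSpace ℝ (Fin 3))) τ x, u τ x⟫) = 0 := by
    intro a b; simp
  -- (5) assembly
  have hLH : IsLerayHopfOn T ν 0 u₀ u := by
    refine fluid_isLerayHopfOn_of_clauses hT0 hν.le hu₀2 (hu.isWeakNSSolutionOn hν hT hT0) ?_ hmemT ?_ hWC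
    · refine ⟨(E₂ ^ 2).toNNReal, (ae_restrict_iff' measurableSet_Ioo).2 (Eventually.of_forall fun t ht => ?_)⟩
      rw [ENNReal.coe_toNNReal (ENNReal.pow_ne_top hE₂t.ne), eEnergy_eq_eLpNorm_sq]
      gcongr
      exact (hA t ⟨ht.1.le, ht.2.trans hTT'⟩).2
    · refine ⟨G, ae_restrict_of_ae_restrict_of_subset (Ioo_subset_Ioo_right hTT'.le) hG,
        (lintegral_mono_set (Ioo_subset_Ioo_right hTT'.le)).trans_lt hGint, fun t ht => ?_, ?_⟩
      · rw [hz, add_zero]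
        exact hB t ⟨ht.1, ht.2.trans_lt hTT'⟩
      · filter_upwards [hCineq] with s hs t ht
        rw [hz, add_zero]
        exact hs t ht
  exact ⟨hLH, h4'.mono_set (Ioo_subset_Ioo_right hTT'.le)⟩

end Main

end Literature.Analysis.FluidPDE
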